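import Literature.Probability.Moments.NoiseDilution
import HarnessLib

/-!
# Probing: the diagonal estimator of Bekas–Kokiopoulou–Saad is EXACT when the probe rows are
# orthogonal on the sparsity pattern; colouring vectors of a proper (distance-`k`) colouring of the
# graph of `A` give `tr A = Σ_b z_bᵀ A z_b` exactly (and `tr A^m`, `m ≤ k`), and for any other
# matrix the probing error is carried only by same-colour pairs beyond graph distance `k`

Topic `Probability/Moments`; sequel of `NoiseDilution.lean` (dilution = partial traces over the
blocks of a scheme `c : n → κ`, `dilute c b z`; full dilution exact) and
`StochasticTraceEstimator.lean` (`traceEst A z = zᵀAz`).  PUBLISHED RESULTS with our formalisation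
of the printed statements and proofs; DETERMINISTIC identities only (the variance statements of
probing-with-noise are those of `NoiseDilution.lean`); no named fact (`def … : Prop` taken as a
hypothesis) is introduced (D-0026) — the two predicates `IsProperColoring`, `IsDistColoring` are
definitions with bodies, used as hypotheses of proved theorems.

HONEST FRAMING: exact (Metropolis-corrected) sampling algorithms for lattice gauge theory;
figures of merit are autocorrelation/cost numbers at stated couplings and volumes; no
continuum-physics claim.

## Sources (read on the materialised texts) and what is taken from each

* C. Bekas, E. Kokiopoulou, Y. Saad, *An estimator for the diagonal of a matrix*, Appl. Numer.
  Math. 57 (2007) 1214–1229 [BekasKokiopoulouSaad2007] (held text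
  `paper:doi-10-1016-j-apnum-2007-01-003`, pp. 3–4, 7–8).  §2.1 eq. (2): the DIAGONAL ESTIMATOR
  `D_s = [Σ_{k=1}^s v_k ⊙ A v_k] ⊘ [Σ_{k=1}^s v_k ⊙ v_k]` ("`⊙` componentwise multiplication,
  `⊘` componentwise division"; "If the vectors `v_k` have entries `±1`, then the trace of `D_s` is
  nothing but the Hutchinson trace estimation of `A`"); eq. (3):
  `D_s^i = a_ii + Σ_{j≠i} a_ij (Σ_k v_k^i v_k^j)/(Σ_k (v_k^i)²)`; §2.2 eq. (4)–(5):
  `Σ_k v_k ⊙ A v_k = Σ_i A_i ⊙ Σ_k v_k^i v_k` with "`Σ_k v_k^i v_k` the `i`-th column of `VVᵀ`",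
  `D_s = [(A ⊙ VVᵀ)e] ⊘ [(V ⊙ V)e]`; "If the matrix `V` has mutually orthogonal rows, then the
  matrix `VVᵀ` will be diagonal, in which case all off-diagonal elements of `A` will be excluded";
  **Proposition 2.1** "Let `V ∈ ℝ^{n×s}` be a matrix the columns of which are used in the diagonal
  estimator. If the `i`-th row of `V` is orthogonal to all those rows `j` of `V` for which
  `a_ij ≠ 0`, then the diagonal estimator will yield an exact result for `a_ii`"; §2.4 (p. 8)
  "if we were to use all rows of the Hadamard matrix as the vectors `v_k` …, then `VVᵀ = nI`.
  Thus, the estimator will yield exactly the diagonal of the unknown matrix."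
* A. Stathopoulos, J. Laeuchli, K. Orginos, *Hierarchical probing for estimating the trace of the
  matrix inverse on toroidal lattices*, SIAM J. Sci. Comput. 35 (2013) S299–S322 = arXiv:1302.4018
  [StathopoulosLaeuchliOrginos2013] (held text `paper:arxiv-1302.4018`, chunks p0004–p0006).
  §1: "Assume that the graph of `A` has a distance-`k` coloring (or distance-1 coloring of the
  graph of `A^k`) with `m` colors. Then, if we define the vectors `z_j`, `j = 1,…,m`, with
  `z_j(i) = 1` if color(`i`) = `j`, and `z_j(i) = 0` otherwise, we obtain
  `Tr(A) = Σ_{j=1}^m z_jᵀAz_j`.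
  For `Tr(A⁻¹)` the equation is not exact, but it annihilates errors from all elements of `A⁻¹`
  that correspond to paths between vertices that are distance-`k` neighbors in `A`."; §1.1.3
  **Proposition 1.2** [Bekas_diagonal] "Let `Z ∈ ℝ^{N×s}` be the matrix of the `s` vectors used in
  the MC trace estimator. If the `i`-th row of `Z` is orthogonal to all those rows `j` of `Z` for
  which `A(i,j) ≠ 0`, then the trace estimator yields the exact `Tr(A)`"; eq. (colorvec) "Assume
  the graph of `A` is colorable with `m` colors … `z_k(i) = 1` if color(`i`) = `k`, `0` otherwise,
  `k = 1,…,m` … Proposition 1.2 applies, and therefore `Tr(A) = Σ_{k=1}^m z_kᵀAz_k`"; §1.1.3 end: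
  "our required distance-`k` coloring is simply the distance-1 coloring of the matrix `A^k`
  [Pothen_Coloring, Tang_Saad_probing]"; §1.1.4: "In LQCD this method is called dilution. In its
  most common form it performs a red-black ordering … all variance caused by the direct red-black
  connections of `A⁻¹` is removed."  (The probing method for `diag(A⁻¹)` is J. M. Tang, Y. Saad,
  Numer. Linear Algebra Appl. 19 (2012) 485–501 [TangSaad2011], cited through the two sources.)

## What is formalised (real matrices `A : Matrix n n ℝ`; probe matrix `V : Matrix n κ ℝ` whose
## COLUMNS `k : κ` are the `s = |κ|` probe vectors, so that row `i` of `V` is `(v_k^i)_k`)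

* `probeNum`, `probeDen`, `diagEst` — eq. (2) and its two accumulators (Fig. 1 lines 2.2–2.3);
  `probeNum_eq` (eq. (4)/(5): `(Σ_k v_k ⊙ Av_k)_i = Σ_j a_ij (VVᵀ)_ij`), `diagEst_eq` (eq. (3)).
* **`diagEst_eq_diag_of_orthogonal`** — PROPOSITION 2.1 (the denominator `Σ_k (v_k^i)² ≠ 0`, which
  eq. (2) presupposes, is an explicit hypothesis); `diagEst_eq_diag_of_mul_transpose_eq_smul_one` —
  the full-Hadamard case `VVᵀ = s·I`.
* **`sum_traceEst_col_of_orthogonal`**, **`avg_traceEst_col_eq_trace`** — PROPOSITION 1.2 of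
  Stathopoulos–Laeuchli–Orginos: under row-orthogonality on the pattern
  `Σ_k z_kᵀAz_k = Σ_i a_ii‖Z_i‖²`, `= s · Tr(A)` for `±1` entries, so the MC estimator
  `(1/s)Σ_k z_kᵀAz_k` is exact.
* `colorMat c` — the colouring vectors (colorvec) as a probe matrix; `col_colorMat_eq_dilute`
  (they are the dilution vectors of the all-ones noise: probing = `dilutedTraceEst c A 1`,
  `sum_traceEst_colorMat`); `IsProperColoring A c`; **`sum_traceEst_colorMat_eq_trace`**
  (`Tr(A) = Σ_b z_bᵀAz_b`) and **`diagEst_colorMat_eq_diag`** (exact diagonal); the general error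
  formula `sum_traceEst_colorMat_eq` (`= Tr(B) + Σ_{i≠j, c i = c j} B_ij` for ANY `B`).
* `Near A k i j` (a walk of length `≤ k` from `i` to `j` in the directed graph `l → j ⇔ A_lj ≠ 0`),
  `near_of_pow_apply_ne_zero` (`(A^k)_ij ≠ 0 ⇒` such a walk), `IsDistColoring A k c`
  (distance-`k` colouring); **`IsDistColoring.isProperColoring_pow`** (a distance-`k` colouring of
  the graph of `A` properly colours the graph of `A^m`, `m ≤ k`, and of every polynomial of degree
  `≤ k` in `A`), **`IsDistColoring.sum_traceEst_pow_eq_trace`**; and the annihilation statement for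
  a general `B = P + E` (`P` subordinate to distance `k`, e.g. a degree-`k` polynomial part of
  `A⁻¹`): **`sum_traceEst_colorMat_add_sub_trace`** — the probing error of `B` is that of `E`
  alone, and (`IsDistColoring.not_near_of_color_eq`) every surviving same-colour pair is beyond
  distance `k`.

NOT formalised: the hierarchical-probing theorems of [StathopoulosLaeuchliOrginos2013] §§2–4
(nested distance-`2^i` colourings of tori and the Hadamard/Fourier orderings that realise them
incrementally); the converse reading "distance-1 colouring of `A^k` ⇒ distance-`k` colouring of
`A`" (it needs absence of cancellation in `A^k`, e.g. nonnegative entries — only the direction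
`IsDistColoring A k c ⇒ IsProperColoring (A^k) c` is proved); decay bounds for `(A⁻¹)_ij`.

Context (cell pub-lqcd, HOME/R2-SCOPE.md §3 E2 N2 / E9, FRESHNESS dilution rows): the stochastic
`tr f(D†D)` / `tr D⁻¹` estimates entering computed proposal densities and reweighting factors are
Hutchinson sums whose variance is the off-diagonal Frobenius mass (`StochasticTraceEstimator`);
dilution (`NoiseDilution`) and probing (this file) strike out the near-diagonal part of that mass
DETERMINISTICALLY — exactness of the estimate for the pattern part, not unbiasedness of
`e^{estimate}` (N2 stands).  No run, no figure of merit of ours.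
-/

noncomputable section

open Finset
open scoped Matrix

namespace Literature.Probability.Moments

namespace StochasticTrace

namespace Probing

open Dilution

variable {n : Type*} [Fintype n] [DecidableEq n] {κ : Type*} [Fintype κ] [DecidableEq κ]

/-! ## The diagonal estimator with an arbitrary probe matrix (Bekas–Kokiopoulou–Saad §2.1–§2.2) -/

/-- The numerator accumulator `t_s = Σ_{k} v_k ⊙ A v_k` of the diagonal estimator, component `i`
(`V i k = v_k^i`, the probe vectors being the columns of `V`). [cite: BekasKokiopoulouSaad2007,
§2.1 eq. (2) and Fig. 1 line 2.2] -/
def probeNum (A : Matrix n n ℝ) (V : Matrix n κ ℝ) (i : n) : ℝ :=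
  ∑ k, V i k * ∑ j, A i j * V j k

/-- The denominator accumulator `q_s = Σ_{k} v_k ⊙ v_k`, component `i` (`= Σ_k (v_k^i)²`).
[cite: BekasKokiopoulouSaad2007, §2.1 eq. (2) and Fig. 1 line 2.3] -/
def probeDen (V : Matrix n κ ℝ) (i : n) : ℝ := ∑ k, V i k * V i k

/-- The DIAGONAL ESTIMATOR `D_s = [Σ_k v_k ⊙ A v_k] ⊘ [Σ_k v_k ⊙ v_k]` (componentwise division;
where the denominator vanishes the value is the junk value `x / 0 = 0` of `ℝ`, and every exactness
statement below assumes it does not). [cite: BekasKokiopoulouSaad2007, §2.1 eq. (2)] -/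
def diagEst (A : Matrix n n ℝ) (V : Matrix n κ ℝ) (i : n) : ℝ := probeNum A V i / probeDen V i

omit [Fintype n] [DecidableEq n] [DecidableEq κ] in
/-- The denominator is the diagonal of `VVᵀ`: `Σ_k (v_k^i)² = (VVᵀ)_ii`.
[cite: BekasKokiopoulouSaad2007, §2.2 eq. (5) (`(V ⊙ V)e`)] -/
theorem probeDen_eq (V : Matrix n κ ℝ) (i : n) : probeDen V i = (V * Vᵀ) i i := by
  unfold probeDen
  rw [Matrix.mul_apply]
  simp only [Matrix.transpose_apply]

omit [DecidableEq n] [DecidableEq κ] in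
/-- Eq. (4)/(5): `(Σ_k v_k ⊙ A v_k)_i = Σ_j a_ij (VVᵀ)_ij` — "the diagonal estimator can be
rewritten as `D_s = [(A ⊙ VVᵀ)e] ⊘ [(V ⊙ V)e]`".
[cite: BekasKokiopoulouSaad2007, §2.2 eq. (4)–(5)] -/
theorem probeNum_eq (A : Matrix n n ℝ) (V : Matrix n κ ℝ) (i : n) :
    probeNum A V i = ∑ j, A i j * (V * Vᵀ) i j := by
  unfold probeNum
  simp_rw [Finset.mul_sum]
  rw [Finset.sum_comm]
  refine Finset.sum_congr rfl fun j _ => ?_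
  rw [Matrix.mul_apply, Finset.mul_sum]
  refine Finset.sum_congr rfl fun k _ => ?_
  rw [Matrix.transpose_apply]
  ring

omit [DecidableEq κ] in
/-- Eq. (3), numerator form:
`(Σ_k v_k ⊙ A v_k)_i = a_ii Σ_k (v_k^i)² + Σ_{j ≠ i} a_ij Σ_k v_k^i v_k^j`.
[cite: BekasKokiopoulouSaad2007, §2.1 eq. (3)] -/
theorem probeNum_eq_diag_add (A : Matrix n n ℝ) (V : Matrix n κ ℝ) (i : n) :
    probeNum A V i = A i i * probeDen V i + ∑ j ∈ univ.erase i, A i j * (V * Vᵀ) i j := by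
  rw [probeNum_eq, probeDen_eq]
  exact (Finset.add_sum_erase _ _ (Finset.mem_univ i)).symm

omit [DecidableEq κ] in
/-- **Eq. (3)**: `D_s^i = a_ii + Σ_{j ≠ i} a_ij (Σ_k v_k^i v_k^j) / (Σ_k (v_k^i)²)` (denominator
nonzero). [cite: BekasKokiopoulouSaad2007, §2.1 eq. (3)] -/
theorem diagEst_eq (A : Matrix n n ℝ) (V : Matrix n κ ℝ) (i : n) (h : probeDen V i ≠ 0) :
    diagEst A V i = A i i + ∑ j ∈ univ.erase i, A i j * (V * Vᵀ) i j / probeDen V i := by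
  unfold diagEst
  rw [probeNum_eq_diag_add, add_div, mul_div_cancel_right₀ _ h, Finset.sum_div]

omit [DecidableEq κ] in
/-- The off-diagonal sum of eq. (3) vanishes when row `i` of `V` is orthogonal to every row `j`
with `a_ij ≠ 0` (the mechanism of Proposition 2.1). [cite: BekasKokiopoulouSaad2007, §2.2
Proposition 2.1 (proof via eq. (3))] -/
theorem sum_erase_eq_zero_of_orthogonal {A : Matrix n n ℝ} {V : Matrix n κ ℝ} {i : n}
    (horth : ∀ j, j ≠ i → A i j ≠ 0 → (V * Vᵀ) i j = 0) :
    ∑ j ∈ univ.erase i, A i j * (V * Vᵀ) i j = 0 := by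
  refine Finset.sum_eq_zero fun j hj => ?_
  have hji : j ≠ i := Finset.ne_of_mem_erase hj
  by_cases hA : A i j = 0
  · rw [hA, zero_mul]
  · rw [horth j hji hA, mul_zero]

omit [DecidableEq κ] in
/-- **PROPOSITION 2.1 (Bekas–Kokiopoulou–Saad).** "Let `V ∈ ℝ^{n×s}` be a matrix the columns of
which are used in the diagonal estimator. If the `i`-th row of `V` is orthogonal to all those rows
`j` of `V` for which `a_ij ≠ 0`, then the diagonal estimator will yield an exact result for `a_ii`"
(row inner products are the entries of `VVᵀ`; the denominator `Σ_k (v_k^i)²` of eq. (2) is assumed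
nonzero, i.e. row `i` of `V` is not zero). [cite: BekasKokiopoulouSaad2007, §2.2 Proposition 2.1] -/
theorem diagEst_eq_diag_of_orthogonal {A : Matrix n n ℝ} {V : Matrix n κ ℝ} {i : n}
    (h : probeDen V i ≠ 0) (horth : ∀ j, j ≠ i → A i j ≠ 0 → (V * Vᵀ) i j = 0) :
    diagEst A V i = A i i := by
  have hz : ∑ j ∈ univ.erase i, A i j * (V * Vᵀ) i j / probeDen V i = 0 := by
    rw [← Finset.sum_div, sum_erase_eq_zero_of_orthogonal horth, zero_div]
  rw [diagEst_eq A V i h, hz, add_zero]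

omit [DecidableEq κ] in
/-- "If the matrix `V` has mutually orthogonal rows, then the matrix `VVᵀ` will be diagonal, in
which case all off-diagonal elements of `A` will be excluded": the estimator is then exact for
EVERY matrix `A` (rows nonzero). [cite: BekasKokiopoulouSaad2007, §2.2 (sentence before
Proposition 2.1)] -/
theorem diagEst_eq_diag_of_rows_orthogonal {V : Matrix n κ ℝ}
    (hVV : ∀ i j, i ≠ j → (V * Vᵀ) i j = 0) (hden : ∀ i, probeDen V i ≠ 0) (A : Matrix n n ℝ) :
    diagEst A V = fun i => A i i :=
  funext fun i => diagEst_eq_diag_of_orthogonal (hden i) fun j hji _ => hVV i j hji.symm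

omit [DecidableEq κ] in
/-- The full-Hadamard case: "if we were to use all rows of the Hadamard matrix as the vectors
`v_k` …, then `VVᵀ = nI`. Thus, the estimator will yield exactly the diagonal of the unknown
matrix" — stated for any probe matrix with `VVᵀ = s·I`, `s ≠ 0`.
[cite: BekasKokiopoulouSaad2007, §2.4 (p. 1221, after Proposition 2.2)] -/
theorem diagEst_eq_diag_of_mul_transpose_eq_smul_one {V : Matrix n κ ℝ} {s : ℝ} (hs : s ≠ 0)
    (hV : V * Vᵀ = s • (1 : Matrix n n ℝ)) (A : Matrix n n ℝ) : diagEst A V = fun i => A i i := by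
  refine diagEst_eq_diag_of_rows_orthogonal (fun i j hij => ?_) (fun i => ?_) A
  · rw [hV, Matrix.smul_apply, Matrix.one_apply_ne hij, smul_zero]
  · rw [probeDen_eq, hV, Matrix.smul_apply, Matrix.one_apply_eq, smul_eq_mul, mul_one]
    exact hs

/-! ## The trace read through the probe vectors (Stathopoulos–Laeuchli–Orginos Proposition 1.2) -/

omit [DecidableEq n] [DecidableEq κ] in
/-- Summing the quadratic forms over the probe vectors: `Σ_k z_kᵀ A z_k = Σ_i Σ_j a_ij (ZZᵀ)_ij`
(the trace of eq. (4)). [cite: BekasKokiopoulouSaad2007, §2.2 eq. (4)];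
[cite: StathopoulosLaeuchliOrginos2013, §1.1.3 Proposition 1.2 (proof mechanism)] -/
theorem sum_traceEst_col (A : Matrix n n ℝ) (V : Matrix n κ ℝ) :
    ∑ k, traceEst A (fun i => V i k) = ∑ i, ∑ j, A i j * (V * Vᵀ) i j := by
  unfold traceEst
  rw [Finset.sum_comm]
  refine Finset.sum_congr rfl fun i _ => ?_
  rw [Finset.sum_comm]
  refine Finset.sum_congr rfl fun j _ => ?_
  rw [Matrix.mul_apply, Finset.mul_sum]
  simp only [Matrix.transpose_apply]

omit [DecidableEq n] [DecidableEq κ] in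
/-- `Σ_k z_kᵀ A z_k = Σ_i (Σ_k z_k ⊙ A z_k)_i` — "the trace of `D_s` is nothing but the Hutchinson
trace estimation" (numerators). [cite: BekasKokiopoulouSaad2007, §2.1 (sentence after Fig. 1)] -/
theorem sum_traceEst_col_eq_sum_probeNum (A : Matrix n n ℝ) (V : Matrix n κ ℝ) :
    ∑ k, traceEst A (fun i => V i k) = ∑ i, probeNum A V i := by
  rw [sum_traceEst_col]
  exact Finset.sum_congr rfl fun i _ => (probeNum_eq A V i).symm

omit [DecidableEq κ] in
/-- **PROPOSITION 1.2 (Stathopoulos–Laeuchli–Orginos, after [Bekas_diagonal]).** "Let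
`Z ∈ ℝ^{N×s}` be the matrix of the `s` vectors used in the MC trace estimator. If the `i`-th row of
`Z` is orthogonal to all those rows `j` of `Z` for which `A(i,j) ≠ 0`, then the trace estimator
yields the exact `Tr(A)`" — the algebraic content: only the diagonal survives,
`Σ_k z_kᵀ A z_k = Σ_i a_ii ‖Z_i‖²`.
[cite: StathopoulosLaeuchliOrginos2013, §1.1.3 Proposition 1.2] -/
theorem sum_traceEst_col_of_orthogonal {A : Matrix n n ℝ} {V : Matrix n κ ℝ}
    (horth : ∀ i j, i ≠ j → A i j ≠ 0 → (V * Vᵀ) i j = 0) :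
    ∑ k, traceEst A (fun i => V i k) = ∑ i, A i i * probeDen V i := by
  rw [sum_traceEst_col_eq_sum_probeNum]
  refine Finset.sum_congr rfl fun i _ => ?_
  rw [probeNum_eq_diag_add, sum_erase_eq_zero_of_orthogonal (fun j hji hA => horth i j hji.symm hA),
    add_zero]

omit [Fintype n] [DecidableEq n] [DecidableEq κ] in
/-- For probe vectors with entries `±1` (Hadamard columns, `Z_2` noise) every row has
`‖Z_i‖² = s`. [cite: StathopoulosLaeuchliOrginos2013, §1.1.4 (Hadamard vectors, entries `±1`)];
[cite: BekasKokiopoulouSaad2007, §2.4 Definition 2.1] -/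
theorem probeDen_eq_card_of_sq_eq_one {V : Matrix n κ ℝ} (hV : ∀ i k, V i k ^ 2 = 1) (i : n) :
    probeDen V i = Fintype.card κ := by
  unfold probeDen
  simp_rw [← pow_two, hV]
  simp

omit [DecidableEq κ] in
/-- **The MC trace estimator is then exact**: with `±1` probe vectors whose rows are orthogonal on
the pattern of `A`, `(1/s) Σ_{k=1}^s z_kᵀ A z_k = Tr(A)` ("the trace estimator yields the exact
`Tr(A)`"). [cite: StathopoulosLaeuchliOrginos2013, §1.1.3 Proposition 1.2] -/
theorem avg_traceEst_col_eq_trace [Nonempty κ] {A : Matrix n n ℝ} {V : Matrix n κ ℝ}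
    (horth : ∀ i j, i ≠ j → A i j ≠ 0 → (V * Vᵀ) i j = 0) (hV : ∀ i k, V i k ^ 2 = 1) :
    (∑ k, traceEst A (fun i => V i k)) / Fintype.card κ = A.trace := by
  rw [sum_traceEst_col_of_orthogonal horth]
  simp_rw [probeDen_eq_card_of_sq_eq_one hV, ← Finset.sum_mul]
  rw [mul_div_cancel_right₀ _ (Nat.cast_ne_zero.mpr Fintype.card_ne_zero)]
  simp [Matrix.trace]

/-! ## Colouring vectors (probing proper; SLO eq. (colorvec), Tang–Saad) -/

/-- The COLOURING PROBE MATRIX of a colouring `c : n → κ`: column `b` is the indicator vector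
`z_b(i) = 1` if color(`i`) `= b`, `0` otherwise. [cite: StathopoulosLaeuchliOrginos2013, §1.1.3
eq. (colorvec)] -/
def colorMat (c : n → κ) : Matrix n κ ℝ := Matrix.of fun i b => if c i = b then 1 else 0

omit [Fintype n] [DecidableEq n] [Fintype κ] in
/-- Unfolding `colorMat`. [cite: StathopoulosLaeuchliOrginos2013, §1.1.3 eq. (colorvec)] -/
@[simp] theorem colorMat_apply (c : n → κ) (i : n) (b : κ) :
    colorMat c i b = if c i = b then 1 else 0 := rfl

omit [Fintype n] [DecidableEq n] [Fintype κ] in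
/-- The colouring vectors ARE the dilution vectors of the all-ones noise vector: probing with a
colouring is dilution (`NoiseDilution.lean`) evaluated at `z ≡ 1` — "In LQCD this method is
called dilution. In its most common form it performs a red-black ordering".
[cite: StathopoulosLaeuchliOrginos2013, §1.1.4 (probing vs. dilution)] -/
theorem col_colorMat_eq_dilute (c : n → κ) (b : κ) :
    (fun i => colorMat c i b) = dilute c b (fun _ => 1) := by
  funext i
  simp [dilute]

omit [Fintype n] [DecidableEq n] in
/-- Row inner products of the colouring matrix: `(ZZᵀ)_ij = 1` if `i`, `j` have the same colour and
`0` otherwise (rows of different colours are orthogonal; "`A(q,q)` has `m` blocks along the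
diagonal … each block is a diagonal matrix"). [cite: StathopoulosLaeuchliOrginos2013, §1.1.3
(paragraph before eq. (colorvec))] -/
theorem colorMat_mul_transpose_apply (c : n → κ) (i j : n) :
    (colorMat c * (colorMat c)ᵀ) i j = if c i = c j then 1 else 0 := by
  rw [Matrix.mul_apply]
  simp only [Matrix.transpose_apply, colorMat_apply, ite_mul, one_mul, zero_mul,
    Finset.sum_ite_eq, Finset.mem_univ, if_true]
  by_cases h : c i = c j
  · rw [if_pos h, if_pos h.symm]
  · rw [if_neg h, if_neg (fun e => h e.symm)]

omit [Fintype n] [DecidableEq n] in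
/-- Each row of the colouring matrix has exactly one entry `1`: the denominator of eq. (2) is `1`.
[cite: StathopoulosLaeuchliOrginos2013, §1.1.3 eq. (colorvec)] -/
theorem probeDen_colorMat (c : n → κ) (i : n) : probeDen (colorMat c) i = 1 := by
  rw [probeDen_eq, colorMat_mul_transpose_apply, if_pos rfl]

omit [DecidableEq n] in
/-- Probing with the colouring vectors is the diluted trace estimator at the all-ones vector:
`Σ_b z_bᵀ A z_b = Σ_b (P^{(b)}1)ᵀ A (P^{(b)}1)`. [cite: StathopoulosLaeuchliOrginos2013, §1.1.4
("In LQCD this method is called dilution")] -/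
theorem sum_traceEst_colorMat (c : n → κ) (A : Matrix n n ℝ) :
    ∑ b, traceEst A (fun i => colorMat c i b) = dilutedTraceEst c A (fun _ => 1) := by
  unfold dilutedTraceEst
  simp_rw [col_colorMat_eq_dilute]

/-- The numerator of the colouring probe at `i`: `a_ii` plus the same-colour off-diagonal entries of
row `i` — the error terms probing leaves. [cite: StathopoulosLaeuchliOrginos2013, §1 ("it
annihilates errors from all elements … that correspond to paths between vertices that are
distance-`k` neighbors")]; [cite: BekasKokiopoulouSaad2007, §2.1 eq. (3)] -/
theorem probeNum_colorMat (c : n → κ) (A : Matrix n n ℝ) (i : n) :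
    probeNum A (colorMat c) i = A i i + ∑ j ∈ univ.erase i, if c i = c j then A i j else 0 := by
  rw [probeNum_eq_diag_add, probeDen_colorMat, mul_one]
  simp_rw [colorMat_mul_transpose_apply, mul_ite, mul_one, mul_zero]

/-- With colouring vectors the diagonal estimator is its numerator (denominator `1`).
[cite: BekasKokiopoulouSaad2007, §2.1 eq. (2)] -/
theorem diagEst_colorMat (c : n → κ) (A : Matrix n n ℝ) (i : n) :
    diagEst A (colorMat c) i = A i i + ∑ j ∈ univ.erase i, if c i = c j then A i j else 0 := by
  rw [← probeNum_colorMat]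
  simp [diagEst, probeDen_colorMat]

/-- **The probing error formula for an arbitrary matrix**: `Σ_b z_bᵀ B z_b = Tr(B) + Σ_{i ≠ j,
c(i) = c(j)} B_ij` — exact up to the same-colour off-diagonal entries ("For `Tr(A⁻¹)` the equation
is not exact …"). [cite: StathopoulosLaeuchliOrginos2013, §1 (paragraph on probing)] -/
theorem sum_traceEst_colorMat_eq (c : n → κ) (B : Matrix n n ℝ) :
    ∑ b, traceEst B (fun i => colorMat c i b) =
      B.trace + ∑ i, ∑ j ∈ univ.erase i, if c i = c j then B i j else 0 := by
  rw [sum_traceEst_col_eq_sum_probeNum]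
  simp_rw [probeNum_colorMat]
  rw [Finset.sum_add_distrib]
  simp [Matrix.trace]

/-- A PROPER COLOURING of the (directed) graph of `A`: indices `i ≠ j` with `a_ij ≠ 0` receive
different colours ("Assume the graph of `A` is colorable with `m` colors"; for a structurally
symmetric `A` this is the usual graph colouring). [cite: StathopoulosLaeuchliOrginos2013, §1.1.3
(paragraph before eq. (colorvec))] -/
def IsProperColoring (A : Matrix n n ℝ) (c : n → κ) : Prop :=
  ∀ ⦃i j : n⦄, i ≠ j → A i j ≠ 0 → c i ≠ c j

omit [Fintype n] [DecidableEq n] in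
/-- Under a proper colouring, row `i` of the colouring matrix is orthogonal to every row `j` with
`a_ij ≠ 0` — the hypothesis of Propositions 2.1 / 1.2 ("we see that Proposition 1.2 applies").
[cite: StathopoulosLaeuchliOrginos2013, §1.1.3 (after eq. (colorvec))] -/
theorem IsProperColoring.orthogonal {A : Matrix n n ℝ} {c : n → κ} (h : IsProperColoring A c)
    (i j : n) (hji : j ≠ i) (hA : A i j ≠ 0) : (colorMat c * (colorMat c)ᵀ) i j = 0 := by
  rw [colorMat_mul_transpose_apply, if_neg (h hji.symm hA)]

omit [Fintype n] [DecidableEq n] [Fintype κ] [DecidableEq κ] in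
/-- Full dilution (an injective scheme, one colour per index) is a proper colouring of every
matrix — the case of `NoiseDilution.dilutedTraceEst_eq_trace_of_injective`.
[cite: StathopoulosLaeuchliOrginos2013, §1.1.4 (dilution as distance-1 probing)] -/
theorem isProperColoring_of_injective {c : n → κ} (hc : Function.Injective c) (A : Matrix n n ℝ) :
    IsProperColoring A c :=
  fun _ _ hij _ e => hij (hc e)

/-- **`Tr(A) = Σ_{k=1}^m z_kᵀ A z_k` for the colouring vectors of a proper colouring of the graph
of `A`** ("we see that Proposition 1.2 applies, and therefore `Tr(A) = Σ_{k=1}^m z_kᵀAz_k`").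
[cite: StathopoulosLaeuchliOrginos2013, §1.1.3 eq. (colorvec) and the display after it] -/
theorem sum_traceEst_colorMat_eq_trace {A : Matrix n n ℝ} {c : n → κ} (h : IsProperColoring A c) :
    ∑ b, traceEst A (fun i => colorMat c i b) = A.trace := by
  rw [sum_traceEst_col_of_orthogonal (fun i j hij hA => h.orthogonal i j hij.symm hA)]
  simp [probeDen_colorMat, Matrix.trace]

/-- **Probing recovers the exact diagonal** under a proper colouring of the graph of `A`
(Proposition 2.1 applied to the colouring vectors — the probing method of Tang–Saad as used in
[StathopoulosLaeuchliOrginos2013]). [cite: BekasKokiopoulouSaad2007, §2.2 Proposition 2.1];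
[cite: StathopoulosLaeuchliOrginos2013, §1.1.3 ("graph coloring can be used to identify the
structurally orthogonal segments of rows, and derive the appropriate probing vectors")] -/
theorem diagEst_colorMat_eq_diag {A : Matrix n n ℝ} {c : n → κ} (h : IsProperColoring A c) :
    diagEst A (colorMat c) = fun i => A i i :=
  funext fun i => diagEst_eq_diag_of_orthogonal (by rw [probeDen_colorMat]; exact one_ne_zero)
    fun j hji hA => h.orthogonal i j hji hA

/-! ## Distance-`k` colourings: exactness for `A^m` (`m ≤ k`) and what survives for `A⁻¹` -/

/-- `Near A k i j`: there is a walk of length at most `k` from `i` to `j` in the directed graph of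
`A` (edge `l → j` iff `a_lj ≠ 0`; staying put is allowed) — "`i` and `j` are at distance `≤ k` in
the graph of `A`". [cite: StathopoulosLaeuchliOrginos2013, §1 ("the distance of the minimum path
between nodes `i` and `j` in the graph of `A`")] -/
def Near (A : Matrix n n ℝ) : ℕ → n → n → Prop
  | 0, i, j => i = j
  | k + 1, i, j => ∃ l, Near A k i l ∧ (l = j ∨ A l j ≠ 0)

omit [Fintype n] [DecidableEq n] in
/-- Distance `0` is equality. [folklore] -/
private theorem near_zero_iff {A : Matrix n n ℝ} {i j : n} : Near A 0 i j ↔ i = j := Iff.rfl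

omit [Fintype n] [DecidableEq n] in
/-- One more step of a walk: stay, or follow an edge `l → j` (`a_lj ≠ 0`). [folklore] -/
private theorem near_succ_iff {A : Matrix n n ℝ} {k : ℕ} {i j : n} :
    Near A (k + 1) i j ↔ ∃ l, Near A k i l ∧ (l = j ∨ A l j ≠ 0) := Iff.rfl

omit [Fintype n] [DecidableEq n] in
/-- Every vertex is within distance `k` of itself. [folklore] -/
private theorem near_refl (A : Matrix n n ℝ) (k : ℕ) (i : n) : Near A k i i := by
  induction k with
  | zero => exact (near_zero_iff).mpr rfl
  | succ k ih => exact ⟨i, ih, Or.inl rfl⟩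

omit [Fintype n] [DecidableEq n] in
/-- Walks of length `≤ k` are walks of length `≤ k + 1`. [folklore] -/
private theorem Near.succ {A : Matrix n n ℝ} {k : ℕ} {i j : n} (h : Near A k i j) :
    Near A (k + 1) i j :=
  ⟨j, h, Or.inl rfl⟩

omit [Fintype n] [DecidableEq n] in
/-- Monotonicity of `Near` in the length bound. [folklore] -/
private theorem Near.mono {A : Matrix n n ℝ} {k m : ℕ} {i j : n} (hkm : k ≤ m)
    (h : Near A k i j) : Near A m i j := by
  induction hkm with
  | refl => exact h
  | step _ ih => exact ih.succ

omit [Fintype n] [DecidableEq n] in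
/-- A nonzero entry `a_ij` is an edge: distance `≤ 1`. [cite: StathopoulosLaeuchliOrginos2013, §1
("the graph of `A`")] -/
theorem near_one_of_ne_zero {A : Matrix n n ℝ} {i j : n} (hA : A i j ≠ 0) : Near A 1 i j :=
  ⟨i, (near_zero_iff).mpr rfl, Or.inr hA⟩

/-- **`(A^k)_ij ≠ 0` only along walks of length `≤ k`** ("Because this graph corresponds to the
matrix `A^k`"): the pattern of `A^k` is subordinate to distance `k` in the graph of `A`.
[cite: StathopoulosLaeuchliOrginos2013, §1.1.3 (last paragraph: distance-`k` colouring = distance-1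
colouring of `A^k`)] -/
theorem near_of_pow_apply_ne_zero (A : Matrix n n ℝ) :
    ∀ (k : ℕ) (i j : n), (A ^ k) i j ≠ 0 → Near A k i j := by
  intro k
  induction k with
  | zero =>
    intro i j h
    by_contra hij
    exact h (by rw [pow_zero, Matrix.one_apply_ne hij])
  | succ k ih =>
    intro i j h
    rw [pow_succ, Matrix.mul_apply] at h
    obtain ⟨l, _, hl⟩ := Finset.exists_ne_zero_of_sum_ne_zero h
    have h1 : (A ^ k) i l ≠ 0 := fun e => hl (by rw [e, zero_mul])
    have h2 : A l j ≠ 0 := fun e => hl (by rw [e, mul_zero])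
    exact ⟨l, ih i l h1, Or.inr h2⟩

/-- A polynomial of degree `≤ k` in `A` (e.g. a truncated Neumann/Chebyshev approximation of `A⁻¹`)
has its pattern subordinate to distance `k`. [cite: StathopoulosLaeuchliOrginos2013, §1.1.3 ("the
power series expansion of `A⁻¹`" as a source of the decay; drop elements "farther than `k` links
apart")] -/
theorem near_of_polynomial_apply_ne_zero (A : Matrix n n ℝ) (a : ℕ → ℝ) (k : ℕ) {i j : n}
    (h : (∑ m ∈ Finset.range (k + 1), a m • A ^ m) i j ≠ 0) : Near A k i j := by
  rw [Matrix.sum_apply] at h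
  obtain ⟨m, hm, hne⟩ := Finset.exists_ne_zero_of_sum_ne_zero h
  rw [Matrix.smul_apply, smul_eq_mul] at hne
  have hA : (A ^ m) i j ≠ 0 := fun e => hne (by rw [e, mul_zero])
  exact (near_of_pow_apply_ne_zero A m i j hA).mono (Nat.lt_succ_iff.mp (Finset.mem_range.mp hm))

/-- A DISTANCE-`k` COLOURING of the graph of `A`: distinct vertices joined by a walk of length
`≤ k` receive different colours ("Assume that the graph of `A` has a distance-`k` coloring").
[cite: StathopoulosLaeuchliOrginos2013, §1 (paragraph on probing)] -/
def IsDistColoring (A : Matrix n n ℝ) (k : ℕ) (c : n → κ) : Prop :=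
  ∀ ⦃i j : n⦄, i ≠ j → Near A k i j → c i ≠ c j

omit [Fintype n] [DecidableEq n] [Fintype κ] [DecidableEq κ] in
/-- A distance-`k` colouring properly colours every matrix whose pattern is subordinate to distance
`k` in the graph of `A`. [cite: StathopoulosLaeuchliOrginos2013, §1.1.3 ("we drop elements
`A⁻¹(i,j)` whose vertices `i` and `j` are farther than `k` links apart … the remaining `A⁻¹` is
sparse and thus colorable")] -/
theorem IsDistColoring.isProperColoring_of_subordinate {A : Matrix n n ℝ} {k : ℕ} {c : n → κ}
    (hc : IsDistColoring A k c) {B : Matrix n n ℝ}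
    (hB : ∀ ⦃i j : n⦄, i ≠ j → B i j ≠ 0 → Near A k i j) : IsProperColoring B c :=
  fun _ _ hij hBij => hc hij (hB hij hBij)

omit [Fintype κ] [DecidableEq κ] in
/-- **A distance-`k` colouring of the graph of `A` is a proper (distance-1) colouring of the graph
of `A^m` for every `m ≤ k`** (the cancellation-free direction of "distance-`k` coloring (or
distance-1 coloring of the graph of `A^k`)"). [cite: StathopoulosLaeuchliOrginos2013, §1 and
§1.1.3 (last paragraph)] -/
theorem IsDistColoring.isProperColoring_pow {A : Matrix n n ℝ} {k m : ℕ} {c : n → κ}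
    (hc : IsDistColoring A k c) (hm : m ≤ k) : IsProperColoring (A ^ m) c :=
  hc.isProperColoring_of_subordinate fun i j _ h => (near_of_pow_apply_ne_zero A m i j h).mono hm

omit [Fintype κ] [DecidableEq κ] in
/-- In particular (`m = 1 ≤ k`) a distance-`k` colouring is a proper colouring of the graph of `A`
itself. [cite: StathopoulosLaeuchliOrginos2013, §1] -/
theorem IsDistColoring.isProperColoring {A : Matrix n n ℝ} {k : ℕ} {c : n → κ}
    (hc : IsDistColoring A k c) (hk : 1 ≤ k) : IsProperColoring A c := by
  simpa only [pow_one] using hc.isProperColoring_pow hk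

omit [Fintype κ] [DecidableEq κ] in
/-- … and of every polynomial of degree `≤ k` in `A`. [cite: StathopoulosLaeuchliOrginos2013, §1.1.3
("the power series expansion of `A⁻¹`")] -/
theorem IsDistColoring.isProperColoring_polynomial {A : Matrix n n ℝ} {k : ℕ} {c : n → κ}
    (hc : IsDistColoring A k c) (a : ℕ → ℝ) :
    IsProperColoring (∑ m ∈ Finset.range (k + 1), a m • A ^ m) c :=
  hc.isProperColoring_of_subordinate fun _ _ _ h => near_of_polynomial_apply_ne_zero A a k h

/-- **"Then … we obtain `Tr(A) = Σ_{j=1}^m z_jᵀ A z_j`" for a distance-`k` colouring — indeed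
`Tr(A^m) = Σ_b z_bᵀ A^m z_b` exactly for every `m ≤ k`.**
[cite: StathopoulosLaeuchliOrginos2013, §1 (paragraph on probing)] -/
theorem IsDistColoring.sum_traceEst_pow_eq_trace {A : Matrix n n ℝ} {k m : ℕ} {c : n → κ}
    (hc : IsDistColoring A k c) (hm : m ≤ k) :
    ∑ b, traceEst (A ^ m) (fun i => colorMat c i b) = (A ^ m).trace :=
  sum_traceEst_colorMat_eq_trace (hc.isProperColoring_pow hm)

/-- The probing error of a polynomial of degree `≤ k` in `A` vanishes under a distance-`k`
colouring. [cite: StathopoulosLaeuchliOrginos2013, §1.1.3 ("Such small elements of `A⁻¹` can be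
dropped, and the remaining `A⁻¹` is sparse and thus colorable")] -/
theorem IsDistColoring.sum_traceEst_polynomial_eq_trace {A : Matrix n n ℝ} {k : ℕ} {c : n → κ}
    (hc : IsDistColoring A k c) (a : ℕ → ℝ) :
    ∑ b, traceEst (∑ m ∈ Finset.range (k + 1), a m • A ^ m) (fun i => colorMat c i b) =
      (∑ m ∈ Finset.range (k + 1), a m • A ^ m).trace :=
  sum_traceEst_colorMat_eq_trace (hc.isProperColoring_polynomial a)

omit [DecidableEq n] [DecidableEq κ] in
/-- The probing sum is additive in the matrix. [folklore] -/
private theorem sum_traceEst_add (P E : Matrix n n ℝ) (V : Matrix n κ ℝ) :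
    ∑ b, traceEst (P + E) (fun i => V i b) =
      ∑ b, traceEst P (fun i => V i b) + ∑ b, traceEst E (fun i => V i b) := by
  rw [← Finset.sum_add_distrib]
  refine Finset.sum_congr rfl fun b _ => ?_
  unfold traceEst
  simp only [Matrix.add_apply, add_mul, Finset.sum_add_distrib]

/-- **Annihilation of the near-pattern error** ("For `Tr(A⁻¹)` the equation is not exact, but it
annihilates errors from all elements of `A⁻¹` that correspond to paths between vertices that are
distance-`k` neighbors in `A`"): split any matrix as `B = P + E` with `P` properly coloured by `c`
(for a distance-`k` colouring: any part of `B` subordinate to distance `k`, e.g. a degree-`k`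
polynomial in `A`); then the probing error of `B` is exactly the probing error of the remainder `E`.
[cite: StathopoulosLaeuchliOrginos2013, §1 (paragraph on probing)] -/
theorem sum_traceEst_colorMat_add_sub_trace {P E : Matrix n n ℝ} {c : n → κ}
    (hP : IsProperColoring P c) :
    ∑ b, traceEst (P + E) (fun i => colorMat c i b) - (P + E).trace =
      ∑ b, traceEst E (fun i => colorMat c i b) - E.trace := by
  rw [sum_traceEst_add, sum_traceEst_colorMat_eq_trace hP, Matrix.trace_add]
  ring

omit [Fintype n] [DecidableEq n] [Fintype κ] [DecidableEq κ] in
/-- … and the surviving error terms `B_ij`, `i ≠ j`, `c(i) = c(j)` (`sum_traceEst_colorMat_eq`) all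
have `i`, `j` FARTHER than `k` apart in the graph of `A`. [cite: StathopoulosLaeuchliOrginos2013,
§1.1.3 ("In the context of probing, we drop elements `A⁻¹(i,j)` whose vertices `i` and `j` are
farther than `k` links apart in the graph of `A`")] -/
theorem IsDistColoring.not_near_of_color_eq {A : Matrix n n ℝ} {k : ℕ} {c : n → κ}
    (hc : IsDistColoring A k c) {i j : n} (hij : i ≠ j) (h : c i = c j) : ¬ Near A k i j :=
  fun hn => hc hij hn h

end Probing

end StochasticTrace

end Literature.Probability.Moments
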